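import Literature.Topology.FourManifolds.RelFundamentalClassOfOrientation
import Literature.Topology.FourManifolds.BoundarySignature
import Mathlib.Topology.Homotopy.Contractible
import Mathlib.Topology.CompactOpen
import HarnessLib

/-!
# The cone neighbourhood of the cone point of the closed model `W ∪ cone(∂W)`

Kervaire–Milnor, *Groups of homotopy spheres I*, Ann. of Math. 77 (1963), footnote pp. 528–529:
the signature of a manifold `W` bounded by a homotopy sphere is computed on the space obtained by
adjoining "a cone over the boundary". The tree realises this closed model as
`Literature.Topology.FourManifolds.ClosedModel n W = OnePoint (W ∖ ∂W)` with the collapse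
`q = boundaryCollapse n W : W → Ŵ` (`BoundarySignature.lean`). This file supplies the point-set
and homotopy-theoretic facts about `Ŵ` near the cone point `∞` needed to orient `Ŵ`
homologically (`ClosedModelConeOrientation.lean`), for the total space of a null-cobordism
`c₀ : NullCobordism (m + 1) M` (`M : Type` closed nonempty) and a collar `κ` of `∂W = M`
(`NullCobordism.exists_boundaryCollar`):

* `NullCobordism.boundaryCollapse_surjective`, `isQuotientMap_boundaryCollapse` — `q` is a
  quotient map (closed, `W` compact); `boundaryCollapse_comp_valICM` — on the interior `q` is the
  open embedding `W ∖ ∂W ↪ Ŵ`;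
* `NullCobordism.collarConeNhd κ = Ŵ ∖ q(W ∖ κ(M × [0,1)))` — **the open cone neighbourhood of `∞`**,
  the image of the open collar: open, contains `∞`, `q⁻¹(collarConeNhd) = κ(M × [0, 1))`
  (`preimage_boundaryCollapse_collarConeNhd`), and together with `Ŵ ∖ ∞` it covers `Ŵ`
  (`interior_compl_infty_union_interior_collarConeNhd`, the excision hypothesis);
* `NullCobordism.contractibleSpace_collarConeNhd` — **the cone neighbourhood is contractible**: sliding
  along the collar lines towards `∂W` descends, through the quotient map `q`, to a contraction onto
  `∞` (`IsQuotientMap.continuous_lift_prod_right`);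
* `IsStrongDeformationRetractOf.homotopyEquiv`, `NullCobordism.isIso_map_inclusion_boundary_below`
  — `∂W ↪ κ(M × [0, t))` is a homotopy equivalence, hence a homology isomorphism;
* `NullCobordism.isIso_map_stripIncl` — the open strip `κ(M × (0, 1)) = κ(M × [0,1)) ∖ ∂W` of the
  interior includes into the open collar by a homology isomorphism (both are copies of `M` up to
  homotopy: `BoundaryCollar.stripHomotopyEquiv` and the slice `a ↦ κ(a, u)` is homotopic in the
  collar to the boundary inclusion).

Everything is proved; no named facts. (Hatcher, *Algebraic Topology* (2002), Example 0.15,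
Prop. 2.22 (`W/∂W`), §3.3 p. 253.)

## References

* M. Kervaire, J. Milnor, *Groups of homotopy spheres I*, Ann. of Math. 77 (1963), §7, footnote
  pp. 528–529. [KervaireMilnorAnnals1963]
* A. Hatcher, *Algebraic Topology*, CUP 2002, Ch. 0 (Example 0.15), Prop. 2.22, §3.3 p. 253.
  [HatcherAT2002]
-/

noncomputable section

open scoped Manifold ContDiff Topology ContinuousMap unitInterval
open Set Function CategoryTheory CategoryTheory.Limits Topology
open Literature.AlgebraicTopology.SingularHomology Literature.AlgebraicTopology.Homotopy

/-! ### Strong deformation retracts are homotopy equivalences -/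

namespace Literature.AlgebraicTopology.Homotopy

namespace IsStrongDeformationRetractOf

universe u v

variable {X : Type u} [TopologicalSpace X] {A S : Set X}

/-- **The inclusion of a strong deformation retract is a homotopy equivalence** `A ≃ₕ S`, with
homotopy inverse the retraction (Hatcher 2002, Ch. 0, p. 3). [cite: HatcherAT2002, Ch. 0, p. 3] -/
def homotopyEquiv (h : IsStrongDeformationRetractOf A S) (hAS : A ⊆ S) : (↥A) ≃ₕ (↥S) where
  toFun := subsetInclusion hAS
  invFun := h.retraction
  left_inv := by
    rw [h.retraction_comp_inclusion hAS]
  right_inv := ⟨(h.homotopyInclusionCompRetraction hAS).symm⟩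

/-- The inclusion of a strong deformation retract induces isomorphisms on singular homology.
[cite: HatcherAT2002, Cor. 2.11] -/
theorem isIso_map_subsetInclusion (R : Type v) [CommRing R] (M : Type v) [AddCommGroup M]
    [Module R M] (h : IsStrongDeformationRetractOf A S) (hAS : A ⊆ S) (k : ℕ) :
    IsIso (singularHomology.map R M (subsetInclusion hAS) k) :=
  (singularHomology.isoOfHomotopyEquiv R M (h.homotopyEquiv hAS) k).isIso_hom

end IsStrongDeformationRetractOf

end Literature.AlgebraicTopology.Homotopy

namespace Literature.AlgebraicTopology.SingularHomology

universe u v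

/-- A continuous map which agrees pointwise with a homeomorphism induces isomorphisms on singular
homology. [folklore] -/
theorem singularHomology.isIso_map_of_homeomorph (R : Type v) [CommRing R] (M : Type v)
    [AddCommGroup M] [Module R M] {X Y : Type u} [TopologicalSpace X] [TopologicalSpace Y]
    (e : X ≃ₜ Y) (f : C(X, Y)) (h : ∀ x, e x = f x) (k : ℕ) : IsIso (singularHomology.map R M f k) := by
  have hf : (e : C(X, Y)) = f := ContinuousMap.ext h
  rw [← hf]
  exact (singularHomology.mapIso R M e k).isIso_hom

end Literature.AlgebraicTopology.SingularHomology

namespace Literature.Topology.FourManifolds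

/-- Local notation: `𝔼 n` is the model Euclidean space `EuclideanSpace ℝ (Fin n)`. -/
local notation "𝔼 " n:arg => EuclideanSpace ℝ (Fin n)

namespace NullCobordism

variable {m : ℕ} {M : Type} [TopologicalSpace M] [ChartedSpace (𝔼 (m + 1)) M]
  [IsManifold (𝓡 (m + 1)) ∞ M] [CompactSpace M] (c₀ : NullCobordism (m + 1) M)

/-! ### The collapse map: surjective, a quotient map, the open embedding on the interior -/

omit [IsManifold (𝓡 (m + 1)) ∞ M] [CompactSpace M] in
/-- The collapse `q : W → Ŵ` is onto (the boundary `∂W = M` is nonempty). [folklore] -/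
theorem boundaryCollapse_surjective [Nonempty M] : Surjective (boundaryCollapse (m + 1) c₀.W) := by
  intro y
  induction y using OnePoint.rec with
  | infty =>
    obtain ⟨x⟩ := ‹Nonempty M›
    exact ⟨c₀.incl x, boundaryCollapse_of_mem_boundary (c₀.incl_mem_boundary x)⟩
  | coe v => exact ⟨v.1, boundaryCollapse_of_mem_interior v.2⟩

omit [IsManifold (𝓡 (m + 1)) ∞ M] [CompactSpace M] in
/-- **The collapse `q : W → W/∂W` is a quotient map** (a continuous closed surjection, `W` being
compact and `Ŵ` Hausdorff; Hatcher 2002, Prop. 2.22). [cite: HatcherAT2002, Prop. 2.22] -/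
theorem isQuotientMap_boundaryCollapse [Nonempty M] : IsQuotientMap (boundaryCollapse (m + 1) c₀.W) :=
  ((boundaryCollapse (m + 1) c₀.W).continuous.isClosedMap).isQuotientMap
    (boundaryCollapse (m + 1) c₀.W).continuous c₀.boundaryCollapse_surjective

/-- The inclusion of the (topological) interior `W ∖ ∂W` into `W`. [folklore] -/
abbrev valICM : C(ManifoldInterior (m + 1) c₀.W, c₀.W) := ⟨Subtype.val, continuous_subtype_val⟩

/-- The open embedding of the interior into the closed model `Ŵ = (W ∖ ∂W) ∪ {∞}`. [folklore] -/
abbrev coeCM : C(ManifoldInterior (m + 1) c₀.W, ClosedModel (m + 1) c₀.W) :=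
  ⟨ClosedModel.ofInterior, OnePoint.continuous_coe⟩

omit [IsManifold (𝓡 (m + 1)) ∞ M] [CompactSpace M] in
/-- On the interior the collapse is the open embedding into the closed model: `q ∘ val = coe`.
[folklore] -/
theorem boundaryCollapse_comp_valICM :
    (boundaryCollapse (m + 1) c₀.W).comp c₀.valICM = c₀.coeCM := by
  ext v
  exact boundaryCollapse_of_mem_interior v.2

omit [IsManifold (𝓡 (m + 1)) ∞ M] [CompactSpace M] in
/-- If `q w = ↑v` for an interior point `v` then `w = v`. [folklore] -/
theorem eq_of_boundaryCollapse_eq_coe {w : c₀.W} {v : ManifoldInterior (m + 1) c₀.W}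
    (h : boundaryCollapse (m + 1) c₀.W w = ClosedModel.ofInterior v) : w = v.1 := by
  by_cases hw : w ∈ (𝓡∂ (m + 1 + 1)).interior c₀.W
  · rw [boundaryCollapse_of_mem_interior hw] at h
    have := OnePoint.coe_injective h
    exact congrArg Subtype.val this
  · rw [boundaryCollapse_apply, boundaryCollapseFun_of_not_mem hw] at h
    exact absurd h (OnePoint.infty_ne_coe v)

/-! ### The cone neighbourhood of `∞` -/

/-- **The open cone neighbourhood of the cone point**: the complement in `Ŵ` of the image of the
core `W ∖ κ(M × [0, 1))`, i.e. `q(κ(M × [0, 1))) = {∞} ∪ κ(M × (0, 1))` — the open cone on `M`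
inside `W ∪ cone(∂W)` (Kervaire–Milnor 1963, footnote pp. 528–529). [cite: KervaireMilnorAnnals1963, §7, footnote pp. 528–529] -/
def collarConeNhd (κ : BoundaryCollar c₀.W M) : Set (ClosedModel (m + 1) c₀.W) :=
  (boundaryCollapse (m + 1) c₀.W '' κ.core 1)ᶜ

omit [IsManifold (𝓡 (m + 1)) ∞ M] [CompactSpace M] in
/-- The cone neighbourhood is open (the image of the compact core is closed). [folklore] -/
theorem isOpen_collarConeNhd (κ : BoundaryCollar c₀.W M) : IsOpen (c₀.collarConeNhd κ) :=
  ((κ.isCompact_core 1).image (boundaryCollapse (m + 1) c₀.W).continuous).isClosed.isOpen_compl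

omit [IsManifold (𝓡 (m + 1)) ∞ M] [CompactSpace M] in
/-- `q w` lies in the cone neighbourhood iff `w` lies in the open collar `κ(M × [0, 1))`.
[folklore] -/
theorem boundaryCollapse_mem_collarConeNhd_iff {κ : BoundaryCollar c₀.W M}
    (hκ : ∀ x : M, κ.collar (x, 0) = c₀.incl x) {w : c₀.W} :
    boundaryCollapse (m + 1) c₀.W w ∈ c₀.collarConeNhd κ ↔ w ∈ κ.below 1 := by
  constructor
  · intro h
    by_contra hw
    exact h ⟨w, hw, rfl⟩
  · rintro hw ⟨w', hw', heq⟩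
    have hw'i : w' ∈ (𝓡∂ (m + 1 + 1)).interior c₀.W := by
      rw [← c₀.boundaryCollar_interior_eq hκ]
      exact κ.core_subset_interior zero_lt_one hw'
    rw [boundaryCollapse_of_mem_interior hw'i] at heq
    have hww : w = w' := c₀.eq_of_boundaryCollapse_eq_coe heq.symm
    subst hww
    exact hw' hw

omit [IsManifold (𝓡 (m + 1)) ∞ M] [CompactSpace M] in
/-- The preimage of the cone neighbourhood under the collapse is the open collar. [folklore] -/
theorem preimage_boundaryCollapse_collarConeNhd {κ : BoundaryCollar c₀.W M}
    (hκ : ∀ x : M, κ.collar (x, 0) = c₀.incl x) :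
    boundaryCollapse (m + 1) c₀.W ⁻¹' c₀.collarConeNhd κ = κ.below 1 :=
  Set.ext fun _ => c₀.boundaryCollapse_mem_collarConeNhd_iff hκ

omit [IsManifold (𝓡 (m + 1)) ∞ M] [CompactSpace M] in
/-- An interior point lies in the cone neighbourhood iff it lies in the open collar. [folklore] -/
theorem coe_mem_collarConeNhd_iff {κ : BoundaryCollar c₀.W M} (hκ : ∀ x : M, κ.collar (x, 0) = c₀.incl x)
    (v : ManifoldInterior (m + 1) c₀.W) :
    ClosedModel.ofInterior v ∈ c₀.collarConeNhd κ ↔ v.1 ∈ κ.below 1 := by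
  obtain ⟨w, hw⟩ := v
  rw [← boundaryCollapse_of_mem_interior hw]
  exact c₀.boundaryCollapse_mem_collarConeNhd_iff hκ

omit [IsManifold (𝓡 (m + 1)) ∞ M] [CompactSpace M] in
/-- The cone point lies in the cone neighbourhood. [folklore] -/
theorem infty_mem_collarConeNhd [Nonempty M] {κ : BoundaryCollar c₀.W M}
    (hκ : ∀ x : M, κ.collar (x, 0) = c₀.incl x) : ClosedModel.infty ∈ c₀.collarConeNhd κ := by
  obtain ⟨x⟩ := ‹Nonempty M›
  have h := (c₀.boundaryCollapse_mem_collarConeNhd_iff hκ).2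
    (c₀.boundary_subset_below hκ zero_lt_one (c₀.incl_mem_boundary x))
  rwa [boundaryCollapse_of_mem_boundary (c₀.incl_mem_boundary x)] at h

omit [IsManifold (𝓡 (m + 1)) ∞ M] [CompactSpace M] in
/-- Points off the cone neighbourhood are interior points (images of the core). [folklore] -/
theorem ne_infty_of_not_mem_collarConeNhd {κ : BoundaryCollar c₀.W M}
    (hκ : ∀ x : M, κ.collar (x, 0) = c₀.incl x) {y : ClosedModel (m + 1) c₀.W}
    (hy : y ∉ c₀.collarConeNhd κ) : y ≠ ClosedModel.infty := by
  obtain ⟨w, hw, rfl⟩ := not_not.1 hy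
  have hwi : w ∈ (𝓡∂ (m + 1 + 1)).interior c₀.W := by
    rw [← c₀.boundaryCollar_interior_eq hκ]
    exact κ.core_subset_interior zero_lt_one hw
  rw [boundaryCollapse_of_mem_interior hwi]
  exact OnePoint.coe_ne_infty _

omit [IsManifold (𝓡 (m + 1)) ∞ M] [CompactSpace M] in
/-- **The excision cover at the cone point**: the interiors of `Ŵ ∖ ∞` and of the cone
neighbourhood cover `Ŵ`. [folklore] -/
theorem interior_compl_infty_union_interior_collarConeNhd {κ : BoundaryCollar c₀.W M}
    (hκ : ∀ x : M, κ.collar (x, 0) = c₀.incl x) :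
    interior ({ClosedModel.infty}ᶜ : Set (ClosedModel (m + 1) c₀.W)) ∪ interior (c₀.collarConeNhd κ) = univ := by
  rw [(c₀.isOpen_collarConeNhd κ).interior_eq,
    (isOpen_compl_singleton (x := (ClosedModel.infty : ClosedModel (m + 1) c₀.W))).interior_eq]
  refine eq_univ_of_forall fun y => ?_
  by_cases hy : y ∈ c₀.collarConeNhd κ
  · exact Or.inr hy
  · exact Or.inl (c₀.ne_infty_of_not_mem_collarConeNhd hκ hy)

/-! ### The cone neighbourhood is contractible -/

section Contractible

variable {c₀}

/-- The level `(1 - s) r` of the collarLineSlide along the collar lines. [folklore] -/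
def slideLevel (s r : I) : I := ⟨(1 - (s : ℝ)) * r, IsStrongDeformationRetractOf.cylinder_scale_mem s r⟩

/-- The collarLineSlide level is jointly continuous. [folklore] -/
theorem continuous_slideLevel : Continuous fun p : I × I => slideLevel p.1 p.2 :=
  ((continuous_const.sub (continuous_subtype_val.comp continuous_fst)).mul
    (continuous_subtype_val.comp continuous_snd)).subtype_mk _

/-- At time `0` the level is unchanged. [folklore] -/
@[simp] theorem slideLevel_zero (r : I) : slideLevel 0 r = r := Subtype.ext (by simp [slideLevel])

/-- At time `1` the level is `0`. [folklore] -/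
@[simp] theorem slideLevel_one (r : I) : slideLevel 1 r = 0 := Subtype.ext (by simp [slideLevel])

/-- The collarLineSlide level does not increase the level. [folklore] -/
theorem slideLevel_le (s r : I) : slideLevel s r ≤ r := by
  show (1 - (s : ℝ)) * r ≤ r
  nlinarith [unitInterval.nonneg s, unitInterval.nonneg r, unitInterval.le_one s]

variable (c₀) [Nonempty M]

/-- Sliding a point of the collar along its collar line: `κ (a, r) ↦ κ (a, (1 - s) r)` (junk off
the collar). [folklore] -/
def collarLineSlide (κ : BoundaryCollar c₀.W M) (s : I) (w : c₀.W) : c₀.W :=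
  κ.collar ((κ.inv w).1, slideLevel s (κ.inv w).2)

omit [IsManifold (𝓡 (m + 1)) ∞ M] [CompactSpace M] in
/-- The collarLineSlide of a collar point. [folklore] -/
theorem collarLineSlide_collar (κ : BoundaryCollar c₀.W M) (s : I) (q : M × I) :
    c₀.collarLineSlide κ s (κ.collar q) = κ.collar (q.1, slideLevel s q.2) := by
  rw [collarLineSlide, κ.inv_collar]

omit [IsManifold (𝓡 (m + 1)) ∞ M] [CompactSpace M] in
/-- The collarLineSlide preserves the open collar. [folklore] -/
theorem collarLineSlide_mem_below {κ : BoundaryCollar c₀.W M} (s : I) {w : c₀.W} (hw : w ∈ κ.below 1) :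
    c₀.collarLineSlide κ s w ∈ κ.below 1 := by
  obtain ⟨q, hq, rfl⟩ := hw
  rw [collarLineSlide_collar]
  exact κ.collar_mem_below_iff.2 (lt_of_le_of_lt (slideLevel_le s q.2) hq)

omit [IsManifold (𝓡 (m + 1)) ∞ M] [CompactSpace M] in
/-- The collarLineSlide is jointly continuous on `[0, 1] × κ(M × [0, 1))`. [folklore] -/
theorem continuous_collarLineSlide_below (κ : BoundaryCollar c₀.W M) :
    Continuous fun p : I × ↥(κ.below 1) => c₀.collarLineSlide κ p.1 p.2 := by
  have hinv : Continuous fun p : I × ↥(κ.below 1) => κ.inv (p.2 : c₀.W) :=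
    κ.continuousOn_inv.comp_continuous (continuous_subtype_val.comp continuous_snd)
      fun p => κ.below_subset_range 1 p.2.2
  refine κ.continuous.comp ((continuous_fst.comp hinv).prodMk ?_)
  exact continuous_slideLevel.comp (continuous_fst.prodMk (continuous_snd.comp hinv))

/-- A boundary point (the image of an arbitrary point of `M`). [folklore] -/
def baseBoundaryPt : c₀.W := c₀.incl (Classical.arbitrary M)

omit [IsManifold (𝓡 (m + 1)) ∞ M] [CompactSpace M] in
/-- The base point is a boundary point. [folklore] -/
theorem baseBoundaryPt_mem_boundary : c₀.baseBoundaryPt ∈ (𝓡∂ (m + 1 + 1)).boundary c₀.W := c₀.incl_mem_boundary _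

/-- A (discontinuous) section of the collapse: `∞ ↦` a boundary point, `↑v ↦ v`. [folklore] -/
def sect (y : ClosedModel (m + 1) c₀.W) : c₀.W :=
  OnePoint.rec c₀.baseBoundaryPt (fun v => v.1) y

omit [IsManifold (𝓡 (m + 1)) ∞ M] [CompactSpace M] in
/-- The section at the cone point is the chosen boundary point. [folklore] -/
@[simp] theorem sect_infty : c₀.sect ClosedModel.infty = c₀.baseBoundaryPt := rfl

omit [IsManifold (𝓡 (m + 1)) ∞ M] [CompactSpace M] in
/-- The section at an interior point is that point. [folklore] -/
@[simp] theorem sect_coe (v : ManifoldInterior (m + 1) c₀.W) : c₀.sect (ClosedModel.ofInterior v) = v.1 := rfl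

omit [IsManifold (𝓡 (m + 1)) ∞ M] [CompactSpace M] in
/-- `sect` is a section of the collapse. [folklore] -/
theorem boundaryCollapse_sect (y : ClosedModel (m + 1) c₀.W) : boundaryCollapse (m + 1) c₀.W (c₀.sect y) = y := by
  induction y using OnePoint.rec with
  | infty => exact boundaryCollapse_of_mem_boundary c₀.baseBoundaryPt_mem_boundary
  | coe v => exact boundaryCollapse_of_mem_interior v.2

omit [IsManifold (𝓡 (m + 1)) ∞ M] [CompactSpace M] in
/-- The section of a point of the cone neighbourhood lies in the open collar. [folklore] -/
theorem sect_mem_below {κ : BoundaryCollar c₀.W M} (hκ : ∀ x : M, κ.collar (x, 0) = c₀.incl x)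
    {y : ClosedModel (m + 1) c₀.W} (hy : y ∈ c₀.collarConeNhd κ) : c₀.sect y ∈ κ.below 1 := by
  rw [← c₀.boundaryCollapse_mem_collarConeNhd_iff hκ, c₀.boundaryCollapse_sect]
  exact hy

omit [IsManifold (𝓡 (m + 1)) ∞ M] [CompactSpace M] in
/-- Sliding a boundary point does not move it. [folklore] -/
theorem collarLineSlide_of_mem_boundary {κ : BoundaryCollar c₀.W M} (hκ : ∀ x : M, κ.collar (x, 0) = c₀.incl x)
    (s : I) {w : c₀.W} (hw : w ∈ (𝓡∂ (m + 1 + 1)).boundary c₀.W) : c₀.collarLineSlide κ s w = w := by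
  rw [← c₀.range_incl] at hw
  obtain ⟨x, rfl⟩ := hw
  rw [← hκ x, collarLineSlide_collar]
  congr 1
  refine Prod.ext rfl (Subtype.ext ?_)
  simp [slideLevel]

/-- **The contraction of the cone neighbourhood**: `(s, q w) ↦ q (κ (a, (1 - s) r))` for
`w = κ (a, r)` in the open collar; at `s = 1` everything is at `q(∂W) = ∞`. [folklore] -/
def collarConeContraction {κ : BoundaryCollar c₀.W M} (hκ : ∀ x : M, κ.collar (x, 0) = c₀.incl x)
    (p : I × ↥(c₀.collarConeNhd κ)) : ↥(c₀.collarConeNhd κ) :=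
  ⟨boundaryCollapse (m + 1) c₀.W (c₀.collarLineSlide κ p.1 (c₀.sect p.2)),
    (c₀.boundaryCollapse_mem_collarConeNhd_iff hκ).2 (c₀.collarLineSlide_mem_below p.1 (c₀.sect_mem_below hκ p.2.2))⟩

omit [IsManifold (𝓡 (m + 1)) ∞ M] [CompactSpace M] in
/-- The contraction lifts the collarLineSlide through the collapse: on the open collar,
`collarConeContraction (s, q w) = q (collarLineSlide s w)`. [folklore] -/
theorem collarConeContraction_apply_boundaryCollapse {κ : BoundaryCollar c₀.W M}
    (hκ : ∀ x : M, κ.collar (x, 0) = c₀.incl x) (s : I) {w : c₀.W}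
    (hw : boundaryCollapse (m + 1) c₀.W w ∈ c₀.collarConeNhd κ) :
    (c₀.collarConeContraction hκ (s, ⟨boundaryCollapse (m + 1) c₀.W w, hw⟩) : ClosedModel (m + 1) c₀.W) =
      boundaryCollapse (m + 1) c₀.W (c₀.collarLineSlide κ s w) := by
  show boundaryCollapse (m + 1) c₀.W (c₀.collarLineSlide κ s (c₀.sect (boundaryCollapse (m + 1) c₀.W w))) = _
  by_cases hwB : w ∈ (𝓡∂ (m + 1 + 1)).boundary c₀.W
  · rw [boundaryCollapse_of_mem_boundary hwB, sect_infty,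
      c₀.collarLineSlide_of_mem_boundary hκ s c₀.baseBoundaryPt_mem_boundary, c₀.collarLineSlide_of_mem_boundary hκ s hwB,
      boundaryCollapse_of_mem_boundary hwB, boundaryCollapse_of_mem_boundary c₀.baseBoundaryPt_mem_boundary]
  · have hwi : w ∈ (𝓡∂ (m + 1 + 1)).interior c₀.W := by
      rw [← ModelWithCorners.compl_boundary]; exact hwB
    rw [boundaryCollapse_of_mem_interior hwi]
    rfl

omit [IsManifold (𝓡 (m + 1)) ∞ M] [CompactSpace M] in
/-- The contraction is continuous (the collapse restricted to the open collar is a quotient map,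
and `[0, 1]` is locally compact). [folklore] -/
theorem continuous_collarConeContraction {κ : BoundaryCollar c₀.W M}
    (hκ : ∀ x : M, κ.collar (x, 0) = c₀.incl x) : Continuous (c₀.collarConeContraction hκ) := by
  have hq : IsQuotientMap ((c₀.collarConeNhd κ).restrictPreimage (boundaryCollapse (m + 1) c₀.W)) :=
    c₀.isQuotientMap_boundaryCollapse.restrictPreimage_isOpen (c₀.isOpen_collarConeNhd κ)
  refine hq.continuous_lift_prod_right (g := c₀.collarConeContraction hκ) ?_
  -- on `[0, 1] × q⁻¹(collarConeNhd) = [0, 1] × κ(M × [0, 1))` the composite is `q ∘ collarLineSlide`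
  have hbelow : ∀ w : ↥(boundaryCollapse (m + 1) c₀.W ⁻¹' c₀.collarConeNhd κ), (w : c₀.W) ∈ κ.below 1 :=
    fun w => (c₀.boundaryCollapse_mem_collarConeNhd_iff hκ).1 w.2
  have hc : Continuous fun p : I × ↥(boundaryCollapse (m + 1) c₀.W ⁻¹' c₀.collarConeNhd κ) =>
      boundaryCollapse (m + 1) c₀.W (c₀.collarLineSlide κ p.1 (p.2 : c₀.W)) := by
    refine (boundaryCollapse (m + 1) c₀.W).continuous.comp ?_
    have h1 : Continuous fun p : I × ↥(boundaryCollapse (m + 1) c₀.W ⁻¹' c₀.collarConeNhd κ) =>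
        ((p.1, ⟨(p.2 : c₀.W), hbelow p.2⟩) : I × ↥(κ.below 1)) :=
      continuous_fst.prodMk ((continuous_subtype_val.comp continuous_snd).subtype_mk _)
    exact (c₀.continuous_collarLineSlide_below κ).comp h1
  have hc' : Continuous fun p : I × ↥(boundaryCollapse (m + 1) c₀.W ⁻¹' c₀.collarConeNhd κ) =>
      (⟨boundaryCollapse (m + 1) c₀.W (c₀.collarLineSlide κ p.1 (p.2 : c₀.W)),
        (c₀.boundaryCollapse_mem_collarConeNhd_iff hκ).2 (c₀.collarLineSlide_mem_below p.1 (hbelow p.2))⟩ :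
          ↥(c₀.collarConeNhd κ)) := hc.subtype_mk _
  refine hc'.congr fun p => Subtype.ext ?_
  exact (c₀.collarConeContraction_apply_boundaryCollapse hκ p.1 p.2.2).symm

omit [IsManifold (𝓡 (m + 1)) ∞ M] [CompactSpace M] in
/-- **The cone neighbourhood of the cone point is contractible** (it is the open cone on `M`).
[cite: KervaireMilnorAnnals1963, §7, footnote pp. 528–529] -/
theorem contractibleSpace_collarConeNhd {κ : BoundaryCollar c₀.W M}
    (hκ : ∀ x : M, κ.collar (x, 0) = c₀.incl x) : ContractibleSpace ↥(c₀.collarConeNhd κ) := by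
  refine (contractible_iff_id_nullhomotopic _).2 ⟨⟨ClosedModel.infty, c₀.infty_mem_collarConeNhd hκ⟩, ⟨?_⟩⟩
  refine
    { toFun := c₀.collarConeContraction hκ
      continuous_toFun := c₀.continuous_collarConeContraction hκ
      map_zero_left := fun y => ?_
      map_one_left := fun y => ?_ }
  · -- at time `0` the collarLineSlide is the identity
    apply Subtype.ext
    obtain ⟨p, hp⟩ : ∃ p, κ.collar p = c₀.sect y :=
      κ.below_subset_range 1 (c₀.sect_mem_below hκ y.2)
    have h1 : c₀.collarLineSlide κ 0 (c₀.sect y) = c₀.sect y := by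
      rw [← hp, collarLineSlide_collar, slideLevel_zero]
    show boundaryCollapse (m + 1) c₀.W (c₀.collarLineSlide κ 0 (c₀.sect y)) = y
    rw [h1, c₀.boundaryCollapse_sect]
  · -- at time `1` everything is on the boundary, i.e. at `∞`
    apply Subtype.ext
    obtain ⟨p, hp⟩ : ∃ p, κ.collar p = c₀.sect y :=
      κ.below_subset_range 1 (c₀.sect_mem_below hκ y.2)
    have h1 : c₀.collarLineSlide κ 1 (c₀.sect y) = c₀.incl p.1 := by
      rw [← hp, collarLineSlide_collar, slideLevel_one, hκ]
    show boundaryCollapse (m + 1) c₀.W (c₀.collarLineSlide κ 1 (c₀.sect y)) = ClosedModel.infty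
    rw [h1]
    exact boundaryCollapse_of_mem_boundary (c₀.incl_mem_boundary p.1)

end Contractible

/-! ### Homology isomorphisms along the collar -/

omit [IsManifold (𝓡 (m + 1)) ∞ M] in
/-- **`∂W ↪ κ(M × [0, t))` is a homology isomorphism** (`∂W` is a strong deformation retract of
the open collar). [cite: HatcherAT2002, Ch. 0, Example 0.15, with Cor. 2.11] -/
theorem isIso_map_inclusion_boundary_below {κ : BoundaryCollar c₀.W M}
    (hκ : ∀ x : M, κ.collar (x, 0) = c₀.incl x) {t : I} (ht : 0 < t) (k : ℕ) :
    IsIso (singularHomology.map ℤ ℤ (subsetInclusion (c₀.boundary_subset_below hκ ht)) k) := by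
  have hsdr : IsStrongDeformationRetractOf ((𝓡∂ (m + 1 + 1)).boundary c₀.W) (κ.below t) := by
    rw [← c₀.range_base_eq_boundary hκ]
    exact κ.isStrongDeformationRetractOf_base_below ht
  exact hsdr.isIso_map_subsetInclusion ℤ ℤ (c₀.boundary_subset_below hκ ht) k

omit [IsManifold (𝓡 (m + 1)) ∞ M] [CompactSpace M] in
/-- The boundary inclusion `M → ∂W ⊆ W` as a homeomorphism onto `∂W`. [folklore] -/
def inclHomeomorph : M ≃ₜ ↥((𝓡∂ (m + 1 + 1)).boundary c₀.W) :=
  c₀.isSmoothEmbedding_incl.isEmbedding.toHomeomorph.trans (Homeomorph.setCongr c₀.range_incl)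

omit [IsManifold (𝓡 (m + 1)) ∞ M] [CompactSpace M] in
/-- The homeomorphism onto the boundary is the boundary inclusion on points. [folklore] -/
@[simp] theorem inclHomeomorph_apply_coe (x : M) : (c₀.inclHomeomorph x : c₀.W) = c₀.incl x := rfl

/-- The boundary inclusion as a continuous map into `∂W`. [folklore] -/
abbrev inclB : C(M, ↥((𝓡∂ (m + 1 + 1)).boundary c₀.W)) := ⟨fun x => ⟨c₀.incl x, c₀.incl_mem_boundary x⟩,
  (c₀.continuous_incl).subtype_mk _⟩

omit [IsManifold (𝓡 (m + 1)) ∞ M] [CompactSpace M] in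
/-- The boundary inclusion `M → ∂W` is a homology isomorphism (a homeomorphism). [folklore] -/
theorem isIso_map_inclB (k : ℕ) : IsIso (singularHomology.map ℤ ℤ c₀.inclB k) :=
  singularHomology.isIso_map_of_homeomorph ℤ ℤ c₀.inclHomeomorph _ (fun _ => rfl) k

/-- The open strip `κ(M × (0, 1))` of the collar, seen in the interior `W ∖ ∂W`: the trace of the
open collar. [folklore] -/
def stripInterior (κ : BoundaryCollar c₀.W M) : Set (ManifoldInterior (m + 1) c₀.W) :=
  Subtype.val ⁻¹' κ.below 1

omit [IsManifold (𝓡 (m + 1)) ∞ M] [CompactSpace M] in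
/-- Membership in the strip of the interior (definitional). [folklore] -/
theorem mem_stripInterior_iff (κ : BoundaryCollar c₀.W M) (v : ManifoldInterior (m + 1) c₀.W) :
    v ∈ c₀.stripInterior κ ↔ v.1 ∈ κ.below 1 := Iff.rfl

omit [IsManifold (𝓡 (m + 1)) ∞ M] [CompactSpace M] in
/-- The inclusion of the interior maps the strip into the open collar. [folklore] -/
theorem mapsTo_val_stripInterior (κ : BoundaryCollar c₀.W M) :
    MapsTo (c₀.valICM : ManifoldInterior (m + 1) c₀.W → c₀.W) (c₀.stripInterior κ) (κ.below 1) :=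
  fun _ hv => hv

/-- **The inclusion of the strip `κ(M × (0,1))` into the open collar `κ(M × [0,1))`**, as a map of
subtypes `↥(stripInterior) → ↥(below 1)`. [folklore] -/
abbrev stripIncl (κ : BoundaryCollar c₀.W M) : C(↥(c₀.stripInterior κ), ↥(κ.below 1)) :=
  subsetRestrict c₀.valICM (c₀.mapsTo_val_stripInterior κ)

omit [IsManifold (𝓡 (m + 1)) ∞ M] [CompactSpace M] in
/-- Points of the strip `κ(M × (0, 1))` are interior points. [folklore] -/
theorem mem_interior_of_mem_strip {κ : BoundaryCollar c₀.W M} (hκ : ∀ x : M, κ.collar (x, 0) = c₀.incl x)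
    {w : c₀.W} (hw : w ∈ κ.strip 1) : w ∈ (𝓡∂ (m + 1 + 1)).interior c₀.W := by
  rw [← c₀.boundaryCollar_interior_eq hκ]
  exact ((κ.strip_eq 1).le hw).1

omit [IsManifold (𝓡 (m + 1)) ∞ M] [CompactSpace M] in
/-- Points of the strip of the interior lie on the strip `κ(M × (0, 1))`. [folklore] -/
theorem val_mem_strip_of_mem_stripInterior {κ : BoundaryCollar c₀.W M}
    (hκ : ∀ x : M, κ.collar (x, 0) = c₀.incl x) {v : ManifoldInterior (m + 1) c₀.W}
    (hv : v ∈ c₀.stripInterior κ) : v.1 ∈ κ.strip 1 := by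
  rw [κ.strip_eq 1]
  refine ⟨?_, hv⟩
  rw [c₀.boundaryCollar_interior_eq hκ]
  exact v.2

omit [IsManifold (𝓡 (m + 1)) ∞ M] [CompactSpace M] in
/-- The strip of the interior is homeomorphic to the strip `κ(M × (0, 1))` of `W`. [folklore] -/
def stripHomeomorphStripInterior {κ : BoundaryCollar c₀.W M}
    (hκ : ∀ x : M, κ.collar (x, 0) = c₀.incl x) : ↥(κ.strip 1) ≃ₜ ↥(c₀.stripInterior κ) where
  toFun w := ⟨⟨w.1, c₀.mem_interior_of_mem_strip hκ w.2⟩, ((κ.strip_eq 1).le w.2).2⟩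
  invFun v := ⟨v.1.1, c₀.val_mem_strip_of_mem_stripInterior hκ v.2⟩
  left_inv _ := rfl
  right_inv _ := rfl
  continuous_toFun := (continuous_subtype_val.subtype_mk _).subtype_mk _
  continuous_invFun := (continuous_subtype_val.comp continuous_subtype_val).subtype_mk _

/-- The slice `a ↦ κ(a, u)` into the strip of the interior, `0 < u < 1`. [folklore] -/
def sliceStrip [Nonempty M] {κ : BoundaryCollar c₀.W M} (hκ : ∀ x : M, κ.collar (x, 0) = c₀.incl x) {u : I}
    (hu0 : 0 < u) (hu1 : u < 1) : C(M, ↥(c₀.stripInterior κ)) :=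
  (c₀.stripHomeomorphStripInterior hκ : C(↥(κ.strip 1), ↥(c₀.stripInterior κ))).comp
    (κ.stripHomotopyEquiv hu0 hu1).toFun

omit [IsManifold (𝓡 (m + 1)) ∞ M] [CompactSpace M] in
/-- The slice on points. [folklore] -/
@[simp] theorem sliceStrip_apply_coe [Nonempty M] {κ : BoundaryCollar c₀.W M} (hκ : ∀ x : M, κ.collar (x, 0) = c₀.incl x)
    {u : I} (hu0 : 0 < u) (hu1 : u < 1) (a : M) :
    ((c₀.sliceStrip hκ hu0 hu1 a : ↥(c₀.stripInterior κ)) : ManifoldInterior (m + 1) c₀.W).1 = κ.collar (a, u) := rfl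

omit [IsManifold (𝓡 (m + 1)) ∞ M] [CompactSpace M] in
/-- The slice into the strip of the interior is a homology isomorphism (a homotopy equivalence
followed by a homeomorphism). [folklore] -/
theorem isIso_map_sliceStrip [Nonempty M] {κ : BoundaryCollar c₀.W M} (hκ : ∀ x : M, κ.collar (x, 0) = c₀.incl x)
    {u : I} (hu0 : 0 < u) (hu1 : u < 1) (k : ℕ) : IsIso (singularHomology.map ℤ ℤ (c₀.sliceStrip hκ hu0 hu1) k) := by
  rw [sliceStrip, singularHomology.map_comp]
  haveI : IsIso (singularHomology.map ℤ ℤ (κ.stripHomotopyEquiv hu0 hu1).toFun k) :=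
    (singularHomology.isoOfHomotopyEquiv ℤ ℤ (κ.stripHomotopyEquiv hu0 hu1) k).isIso_hom
  haveI : IsIso (singularHomology.map ℤ ℤ
      (c₀.stripHomeomorphStripInterior hκ : C(↥(κ.strip 1), ↥(c₀.stripInterior κ))) k) :=
    (singularHomology.mapIso ℤ ℤ (c₀.stripHomeomorphStripInterior hκ) k).isIso_hom
  infer_instance

/-- The boundary inclusion as a map into the open collar `κ(M × [0, 1))`. [folklore] -/
def bottomBelow {κ : BoundaryCollar c₀.W M} (hκ : ∀ x : M, κ.collar (x, 0) = c₀.incl x) :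
    C(M, ↥(κ.below 1)) :=
  (subsetInclusion (c₀.boundary_subset_below hκ zero_lt_one)).comp c₀.inclB

omit [IsManifold (𝓡 (m + 1)) ∞ M] in
/-- The boundary inclusion into the open collar is a homology isomorphism. [folklore] -/
theorem isIso_map_bottomBelow {κ : BoundaryCollar c₀.W M} (hκ : ∀ x : M, κ.collar (x, 0) = c₀.incl x)
    (k : ℕ) : IsIso (singularHomology.map ℤ ℤ (c₀.bottomBelow hκ) k) := by
  rw [bottomBelow, singularHomology.map_comp]
  haveI := c₀.isIso_map_inclusion_boundary_below hκ zero_lt_one k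
  haveI := c₀.isIso_map_inclB k
  infer_instance

omit [IsManifold (𝓡 (m + 1)) ∞ M] [CompactSpace M] in
/-- **The slice `a ↦ κ(a, u)` is homotopic, inside the open collar, to the boundary inclusion
`a ↦ κ(a, 0)`** (collarLineSlide the level from `u` to `0`). [folklore] -/
theorem stripIncl_comp_sliceStrip_homotopic_bottomBelow [Nonempty M] {κ : BoundaryCollar c₀.W M}
    (hκ : ∀ x : M, κ.collar (x, 0) = c₀.incl x) {u : I} (hu0 : 0 < u) (hu1 : u < 1) :
    ((c₀.stripIncl κ).comp (c₀.sliceStrip hκ hu0 hu1)).Homotopic (c₀.bottomBelow hκ) := by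
  refine ⟨{ toFun := fun p => ⟨κ.collar (p.2, slideLevel p.1 u),
              κ.collar_mem_below_iff.2 (lt_of_le_of_lt (slideLevel_le p.1 u) hu1)⟩
            continuous_toFun := ?_
            map_zero_left := fun a => ?_
            map_one_left := fun a => ?_ }⟩
  · refine (κ.continuous.comp (continuous_snd.prodMk ?_)).subtype_mk _
    exact continuous_slideLevel.comp (continuous_fst.prodMk continuous_const)
  · apply Subtype.ext
    show κ.collar (a, slideLevel 0 u) = κ.collar (a, u)
    rw [slideLevel_zero]
  · apply Subtype.ext
    show κ.collar (a, slideLevel 1 u) = c₀.incl a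
    rw [slideLevel_one, hκ]

omit [IsManifold (𝓡 (m + 1)) ∞ M] in
/-- **The strip `κ(M × (0,1))` includes into the open collar `κ(M × [0,1))` by a homology
isomorphism**: the slice `a ↦ κ(a, ½)` is a homotopy equivalence `M ≃ κ(M × (0,1))`
(`BoundaryCollar.stripHomotopyEquiv`) and is homotopic, inside the open collar, to the boundary
inclusion `a ↦ κ(a, 0)`, which is a homology isomorphism (`isIso_map_inclusion_boundary_below`).
[cite: HatcherAT2002, Ch. 0, Example 0.15, with Cor. 2.11] -/
theorem isIso_map_stripIncl [Nonempty M] {κ : BoundaryCollar c₀.W M}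
    (hκ : ∀ x : M, κ.collar (x, 0) = c₀.incl x) (k : ℕ) :
    IsIso (singularHomology.map ℤ ℤ (c₀.stripIncl κ) k) := by
  -- the half level
  let u : I := ⟨(1 : ℝ) / 2, by constructor <;> norm_num⟩
  have hu0 : 0 < u := by show (0 : ℝ) < 1 / 2; norm_num
  have hu1 : u < 1 := by show (1 : ℝ) / 2 < 1; norm_num
  have hcomp : singularHomology.map ℤ ℤ (c₀.sliceStrip hκ hu0 hu1) k ≫ singularHomology.map ℤ ℤ (c₀.stripIncl κ) k =
      singularHomology.map ℤ ℤ (c₀.bottomBelow hκ) k := by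
    rw [← singularHomology.map_comp,
      singularHomology.map_eq_of_homotopic ℤ ℤ (c₀.stripIncl_comp_sliceStrip_homotopic_bottomBelow hκ hu0 hu1)]
  haveI := c₀.isIso_map_sliceStrip hκ hu0 hu1 k
  haveI : IsIso (singularHomology.map ℤ ℤ (c₀.sliceStrip hκ hu0 hu1) k ≫ singularHomology.map ℤ ℤ (c₀.stripIncl κ) k) := by
    rw [hcomp]; exact c₀.isIso_map_bottomBelow hκ k
  exact IsIso.of_isIso_comp_left (singularHomology.map ℤ ℤ (c₀.sliceStrip hκ hu0 hu1) k) _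

end NullCobordism

end Literature.Topology.FourManifolds

end
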